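import Mathlib
import HarnessLib
import Summits.Ventures.LatticeQCDFlow.Exactness.NCMCGeneralSpaceEstimatorCLT

/-!
# The reported error bar is asymptotically honest: the studentized CLT for the free-energy estimate and the coverage of `dF ± z·err`

HONEST FRAMING: exact (Metropolis-corrected) sampling algorithms for lattice gauge theory;
figures of merit are autocorrelation/cost numbers at stated couplings and volumes; no
continuum-physics claim.

Venture `LatticeQCDFlow` (cell pub-lqcd), topic `Exactness`; FANOUT row 13 (`eng-snf`, GEN-13).
NEW WORK of the cell (elementary asymptotic statistics: Slutsky's theorem and one implication of
the portmanteau theorem, both from Mathlib), not a published result; nothing is cited as a fact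
("Student"/W. S. Gosset 1908 and E. Slutsky 1925 named only).  Continuation of
`NCMCGeneralSpaceEstimatorCLT.lean` (GEN-12: `√n (ΔF̂_n − ΔF) →d N(0, 1/ESS_F − 1)`) and
`NCMCGeneralSpaceEstimatorConsistency.lean` (GEN-11: `essHat_n → ESS_F` a.s.).  Those two files say
what the VARIANCE of the free-energy estimate is and that the reported Kish fraction estimates it
consistently; this file puts them together into the statement a user of the engine's
`estimators.free_energy` output `(dF, err)` actually relies on: with the PLUG-IN error bar
`err_n = √((1/essHat_n − 1)/n)` the pivot `(ΔF̂_n − ΔF)/err_n` is asymptotically standard normal,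
so the interval `dF ± z·err` has asymptotic coverage `P(|N(0,1)| ≤ z)`.

## Setting and content

`μ` a probability law on records `E`, a positive measurable weight `w ∈ L²(μ)` with `θ = E_μ w` and
`Var_μ[w] > 0` (NON-DEGENERACY: for a Crooks pair `Var_F e^{−W} = 0` iff `W = ΔF` a.s. iff
`ESS_F = 1`, `NCMCGeneralSpaceDissipationFree.lean` — then `err_n = 0` and there is nothing to
studentize); the run `ω : ℕ → E` carries `Measure.infinitePi (fun _ => μ)`;
`ΔF̂_n = jarzynskiEstimate w (ω 0, …, ω (n−1))`, `essHat_n = essHat (w(ω i))_{i<n}`.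

* `measurable_essHat_run`, `tendsto_inv_sqrt_inv_essHat_sub_one_ae`
  (`(1/essHat_n − 1)^{−1/2} → (Var_μ[w]/θ²)^{−1/2}` a.s.), bookkeeping;
* **`tendstoInDistribution_studentized_jarzynskiEstimate`** — THE STUDENTIZED CLT:
  `√n (ΔF̂_n − (−log θ)) / √(1/essHat_n − 1) →d N(0, 1)` (GEN-12's CLT with limit `√v·Z`,
  `v = Var_μ[w]/θ²`, times the a.s.-convergent factor `(1/essHat_n − 1)^{−1/2} → v^{−1/2}`; Slutsky);
* **`tendsto_measure_abs_studentized_le`** — COVERAGE: for `z ≥ 0`,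
  `μ^{⊗ℕ} {|√n (ΔF̂_n + log θ)| ≤ z √(1/essHat_n − 1)} → gaussianReal 0 1 [−z, z]` (portmanteau:
  the Gaussian puts no mass on the two-point frontier).
* For a Crooks pair `(κF, κR, s, e, W)` from `ν₀` to `ν₁` with `e^{−W} ∈ L²(P_F)`, `e^{−ΔF} = Z₁/Z₀`
  and `Var_F e^{−W} > 0`, along independent forward evolutions from prior equilibrium:
  **`CrooksPair.tendstoInDistribution_studentized`** — `√n (ΔF̂_n − ΔF)/√(1/essHat_n − 1) →d N(0,1)`,
  and **`CrooksPair.tendsto_measure_abs_sub_le_mul_err`** — THE REPORTED INTERVAL IS ASYMPTOTICALLY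
  HONEST: `P_F^{⊗ℕ} {|ΔF̂_n − ΔF| · √n ≤ z · √(1/essHat_n − 1)} → N(0,1)([−z, z])`, i.e. the event
  "`ΔF` lies in `dF ± z·err`" with `err = √((1/essHat_n − 1)/n)` has limiting probability
  `P(|N(0,1)| ≤ z)` (`≈ 0.95` at `z = 1.96` — a property of the standard normal, not typed here).

Scope / NOT CLAIMED: independent evolutions only (for correlated chain starts the plug-in `err`
is NOT justified by this file); asymptotic coverage only — no finite-`N` guarantee (see
`NCMCGeneralSpaceEstimatorChebyshev.lean` for a distribution-free finite-`N` statement) and no rate;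
nothing for the degenerate dissipation-free case; no value for any concrete protocol.
-/

namespace Summit.Ventures.LatticeQCDFlow.Exactness.GeneralNCMC

open MeasureTheory ProbabilityTheory Set Filter Finset
open scoped ENNReal NNReal Topology

variable {E : Type*} [MeasurableSpace E]

section IID

variable (μ : Measure E) [IsProbabilityMeasure μ]
variable {Ω' : Type*} [MeasurableSpace Ω'] {P' : Measure Ω'} [IsProbabilityMeasure P']

/-! ## Bookkeeping: measurability of the Kish fraction, the a.s. limit of the studentizing factor -/

omit [IsProbabilityMeasure μ] in
/-- The reported Kish fraction of the first `n` coordinates is a measurable function of the run. -/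
theorem measurable_essHat_run {w : E → ℝ} (hwm : Measurable w) (n : ℕ) :
    Measurable fun ω : ℕ → E => essHat (fun i : Fin n => w (ω i)) := by
  unfold essHat
  have hs : Measurable fun ω : ℕ → E => ∑ i : Fin n, w (ω i) :=
    Finset.measurable_sum _ fun i _ => hwm.comp (measurable_pi_apply (i : ℕ))
  have hs2 : Measurable fun ω : ℕ → E => ∑ i : Fin n, w (ω i) ^ 2 :=
    Finset.measurable_sum _ fun i _ => (hwm.comp (measurable_pi_apply (i : ℕ))).pow_const 2
  exact (hs.pow_const 2).div (measurable_const.mul hs2)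

/-- `1/ESS − 1 = Var_μ[w]/θ²` with `ESS = θ²/E_μ w²`. -/
theorem one_div_essPop_sub_one {w : E → ℝ} (hL2 : MemLp w 2 μ) (hθ : ∫ a, w a ∂μ ≠ 0) :
    1 / ((∫ a, w a ∂μ) ^ 2 / ∫ a, w a ^ 2 ∂μ) - 1 = Var[w; μ] / (∫ a, w a ∂μ) ^ 2 := by
  have hv : Var[w; μ] = (∫ a, w a ^ 2 ∂μ) - (∫ a, w a ∂μ) ^ 2 := by
    rw [variance_eq_sub hL2]
    rfl
  rw [hv, one_div_div, sub_div, div_self (pow_ne_zero 2 hθ)]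

/-- **The studentizing factor converges a.s.**: `(1/essHat_n − 1)^{−1/2} → (Var_μ[w]/θ²)^{−1/2}`
along the run (positive weight in `L²`, `Var_μ[w] > 0`). -/
theorem tendsto_inv_sqrt_inv_essHat_sub_one_ae {w : E → ℝ} (hwm : Measurable w)
    (hwpos : ∀ a, 0 < w a) (hL2 : MemLp w 2 μ) (hvar : 0 < Var[w; μ]) :
    ∀ᵐ ω ∂(Measure.infinitePi fun _ : ℕ => μ),
      Tendsto (fun n : ℕ => (√(1 / essHat (fun i : Fin n => w (ω i)) - 1))⁻¹) atTop
        (𝓝 (√(Var[w; μ] / (∫ a, w a ∂μ) ^ 2))⁻¹) := by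
  have hwi : Integrable w μ := hL2.integrable one_le_two
  have hθ : 0 < ∫ a, w a ∂μ := by
    rw [integral_pos_iff_support_of_nonneg (fun a => (hwpos a).le) hwi]
    have hsupp : Function.support w = univ := by
      ext a
      simp only [Function.mem_support, mem_univ, iff_true]
      exact (hwpos a).ne'
    rw [hsupp, measure_univ]
    exact one_pos
  have hsq : ∫ a, w a ^ 2 ∂μ ≠ 0 := by
    have h2 : 0 < ∫ a, w a ^ 2 ∂μ := by
      rw [integral_pos_iff_support_of_nonneg (fun a => sq_nonneg (w a)) hL2.integrable_sq]
      have hsupp : Function.support (fun a => w a ^ 2) = univ := by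
        ext a
        simp only [Function.mem_support, mem_univ, iff_true]
        exact (pow_pos (hwpos a) 2).ne'
      rw [hsupp, measure_univ]
      exact one_pos
    exact h2.ne'
  have hv : 0 < Var[w; μ] / (∫ a, w a ∂μ) ^ 2 := div_pos hvar (pow_pos hθ 2)
  filter_upwards [tendsto_essHat_ae μ hwm hL2 hsq] with ω hω
  have hlim : Tendsto (fun n : ℕ => 1 / essHat (fun i : Fin n => w (ω i)) - 1) atTop
      (𝓝 (Var[w; μ] / (∫ a, w a ∂μ) ^ 2)) := by
    rw [← one_div_essPop_sub_one μ hL2 hθ.ne']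
    exact ((tendsto_const_nhds.div hω (div_ne_zero (pow_ne_zero 2 hθ.ne') hsq))).sub_const 1
  exact (hlim.sqrt).inv₀ (Real.sqrt_pos.2 hv).ne'

/-! ## The studentized CLT -/

/-- **Studentized CLT for the Jarzynski estimate.**  For a positive measurable weight `w ∈ L²(μ)`
with `Var_μ[w] > 0` and `θ = E_μ w`, along an infinite i.i.d. run,
`√n (ΔF̂_n − (−log θ)) / √(1/essHat_n − 1) →d N(0, 1)`. -/
theorem tendstoInDistribution_studentized_jarzynskiEstimate {w : E → ℝ} (hwm : Measurable w)
    (hwpos : ∀ a, 0 < w a) (hL2 : MemLp w 2 μ) (hvar : 0 < Var[w; μ]) {Z : Ω' → ℝ}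
    (hZ : HasLaw Z (gaussianReal 0 1) P') :
    TendstoInDistribution
      (fun (n : ℕ) (ω : ℕ → E) => √(n : ℝ) *
          (jarzynskiEstimate w (fun i : Fin n => ω i) - -Real.log (∫ a, w a ∂μ)) /
        √(1 / essHat (fun i : Fin n => w (ω i)) - 1))
      atTop Z (fun _ => Measure.infinitePi fun _ : ℕ => μ) P' := by
  set P := Measure.infinitePi fun _ : ℕ => μ with hP
  set θ := ∫ a, w a ∂μ with hθdef
  set v := Var[w; μ] / θ ^ 2 with hvdef
  have hwi : Integrable w μ := hL2.integrable one_le_two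
  have hθ : 0 < θ := by
    rw [hθdef, integral_pos_iff_support_of_nonneg (fun a => (hwpos a).le) hwi]
    have hsupp : Function.support w = univ := by
      ext a
      simp only [Function.mem_support, mem_univ, iff_true]
      exact (hwpos a).ne'
    rw [hsupp, measure_univ]
    exact one_pos
  have hv : 0 < v := div_pos hvar (pow_pos hθ 2)
  have hsv : √v ≠ 0 := (Real.sqrt_pos.2 hv).ne'
  -- `Y = √v · Z ~ N(0, v)`: GEN-12's CLT applies with this limit variable
  have hY : HasLaw (fun ω' => √v * Z ω') (gaussianReal 0 (Var[w; μ] / (∫ a, w a ∂μ) ^ 2).toNNReal) P' := by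
    have h := gaussianReal_const_mul hZ (√v)
    rw [mul_zero, mul_one] at h
    convert h using 3
    apply NNReal.eq
    rw [Real.coe_toNNReal _ hv.le, NNReal.coe_mk, Real.sq_sqrt hv.le]
  have clt := tendstoInDistribution_sqrt_mul_jarzynskiEstimate_sub μ hwm hwpos hL2 hY
  -- the studentizing factor converges in probability to `(√v)⁻¹`
  have hUmeas : ∀ n : ℕ, AEMeasurable
      (fun ω : ℕ → E => (√(1 / essHat (fun i : Fin n => w (ω i)) - 1))⁻¹) P :=
    fun n => (((measurable_essHat_run hwm n).const_div 1).sub_const 1).sqrt.inv.aemeasurable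
  have hU : TendstoInMeasure P
      (fun (n : ℕ) (ω : ℕ → E) => (√(1 / essHat (fun i : Fin n => w (ω i)) - 1))⁻¹)
      atTop (fun _ => (√v)⁻¹) :=
    tendstoInMeasure_of_tendsto_ae (fun n => (hUmeas n).aestronglyMeasurable)
      (tendsto_inv_sqrt_inv_essHat_sub_one_ae μ hwm hwpos hL2 hvar)
  have slutsky := clt.continuous_comp_prodMk_of_tendstoInMeasure_const
    (g := fun p : ℝ × ℝ => p.1 * p.2) (by fun_prop) hU hUmeas
  refine slutsky.congr (fun n => Eventually.of_forall fun ω => ?_)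
    (Eventually.of_forall fun ω' => ?_)
  · simp only [div_eq_mul_inv, hθdef]
  · show √v * Z ω' * (√v)⁻¹ = Z ω'
    rw [mul_comm (√v) (Z ω'), mul_inv_cancel_right₀ hsv]

/-- **Coverage of the studentized interval.**  For `z ≥ 0`,
`μ^{⊗ℕ} {|√n (ΔF̂_n + log θ) / √(1/essHat_n − 1)| ≤ z} → gaussianReal 0 1 [−z, z]` (one implication
of the portmanteau theorem: the standard Gaussian puts no mass on the frontier `{−z, z}`). -/
theorem tendsto_measure_abs_studentized_le {w : E → ℝ} (hwm : Measurable w)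
    (hwpos : ∀ a, 0 < w a) (hL2 : MemLp w 2 μ) (hvar : 0 < Var[w; μ]) {z : ℝ} (hz : 0 ≤ z) :
    Tendsto (fun n : ℕ => (Measure.infinitePi fun _ : ℕ => μ)
        {ω | |√(n : ℝ) * (jarzynskiEstimate w (fun i : Fin n => ω i) - -Real.log (∫ a, w a ∂μ)) /
          √(1 / essHat (fun i : Fin n => w (ω i)) - 1)| ≤ z})
      atTop (𝓝 (gaussianReal 0 1 (Icc (-z) z))) := by
  have h := tendstoInDistribution_studentized_jarzynskiEstimate μ hwm hwpos hL2 hvar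
    (P' := gaussianReal 0 1) (Z := id) HasLaw.id
  have hnull : ((gaussianReal 0 1).map id) (frontier (Icc (-z) z)) = 0 := by
    rw [Measure.map_id, frontier_Icc (by linarith : -z ≤ z)]
    haveI := nullSingletonClass_gaussianReal (μ := 0) (v := 1) one_ne_zero
    exact (Set.toFinite {-z, z}).measure_zero _
  have key := ProbabilityMeasure.tendsto_measure_of_null_frontier_of_tendsto' h.tendsto
    (E := Icc (-z) z) (by simpa using hnull)
  simp only [ProbabilityMeasure.coe_mk, Measure.map_id] at key
  refine key.congr fun n => ?_
  rw [Measure.map_apply_of_aemeasurable (h.forall_aemeasurable n) measurableSet_Icc]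
  congr 1
  ext ω
  simp only [Set.mem_preimage, Set.mem_Icc, mem_setOf_eq, abs_le]

end IID

/-! ## For a Crooks pair: the engine's `(dF, err)` pair is an asymptotically exact pivot -/

namespace CrooksPair

variable {Ω : Type*} [MeasurableSpace Ω]
variable {ν₀ ν₁ : Measure Ω} {κF κR : Kernel Ω E} {s e : E → Ω} {W : E → ℝ}
variable {Ω' : Type*} [MeasurableSpace Ω'] {P' : Measure Ω'} [IsProbabilityMeasure P']

/-- **Studentized CLT for a Crooks pair.**  For every Crooks pair on a general measurable state
space with `e^{−W} ∈ L²(P_F)`, `e^{−ΔF} = Z₁/Z₀` and `Var_F e^{−W} > 0` (the protocol is not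
dissipation-free), along an infinite run of independent forward evolutions,
`√n (ΔF̂_n − ΔF) / √(1/essHat_n − 1) →d N(0, 1)`. -/
theorem tendstoInDistribution_studentized [IsFiniteMeasure ν₀] [IsFiniteMeasure ν₁]
    [IsMarkovKernel κF] [IsMarkovKernel κR] (h0 : ν₀ univ ≠ 0)
    (h : CrooksPair ν₀ ν₁ κF κR s e W)
    (hL2 : MemLp (fun ε => Real.exp (-W ε)) 2 (fwdPathLaw ν₀ κF))
    (hvar : 0 < Var[fun ε => Real.exp (-W ε); fwdPathLaw ν₀ κF]) {ΔF : ℝ}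
    (hΔF : Real.exp (-ΔF) = ((ν₀ univ)⁻¹ * ν₁ univ).toReal) {Z : Ω' → ℝ}
    (hZ : HasLaw Z (gaussianReal 0 1) P') :
    haveI := isProbabilityMeasure_fwdPathLaw ν₀ h0 κF
    TendstoInDistribution
      (fun (n : ℕ) (ω : ℕ → E) => √(n : ℝ) *
          (jarzynskiEstimate (fun ε => Real.exp (-W ε)) (fun i : Fin n => ω i) - ΔF) /
        √(1 / essHat (fun i : Fin n => Real.exp (-W (ω i))) - 1))
      atTop Z (fun _ => Measure.infinitePi fun _ : ℕ => fwdPathLaw ν₀ κF) P' := by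
  haveI := isProbabilityMeasure_fwdPathLaw ν₀ h0 κF
  have key := tendstoInDistribution_studentized_jarzynskiEstimate (fwdPathLaw ν₀ κF)
    (w := fun ε => Real.exp (-W ε)) (Real.measurable_exp.comp h.measurable_W.neg)
    (fun ε => Real.exp_pos _) hL2 hvar hZ
  rwa [h.integral_exp_neg_work, ← hΔF, Real.log_exp, neg_neg] at key

/-- **The reported interval `dF ± z·err` is asymptotically honest.**  With
`err_n = √((1/essHat_n − 1)/n)` the engine's plug-in error bar, for every `z ≥ 0` the probability
that `|ΔF̂_n − ΔF| · √n ≤ z · √(1/essHat_n − 1)` — i.e. that `ΔF ∈ [ΔF̂_n − z·err_n, ΔF̂_n + z·err_n]`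
whenever `err_n > 0` — converges to `gaussianReal 0 1 [−z, z] = P(|N(0,1)| ≤ z)`. -/
theorem tendsto_measure_abs_sub_le_mul_err [IsFiniteMeasure ν₀] [IsFiniteMeasure ν₁]
    [IsMarkovKernel κF] [IsMarkovKernel κR] (h0 : ν₀ univ ≠ 0)
    (h : CrooksPair ν₀ ν₁ κF κR s e W)
    (hL2 : MemLp (fun ε => Real.exp (-W ε)) 2 (fwdPathLaw ν₀ κF))
    (hvar : 0 < Var[fun ε => Real.exp (-W ε); fwdPathLaw ν₀ κF]) {ΔF : ℝ}
    (hΔF : Real.exp (-ΔF) = ((ν₀ univ)⁻¹ * ν₁ univ).toReal) {z : ℝ} (hz : 0 ≤ z) :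
    haveI := isProbabilityMeasure_fwdPathLaw ν₀ h0 κF
    Tendsto (fun n : ℕ => (Measure.infinitePi fun _ : ℕ => fwdPathLaw ν₀ κF)
        {ω | |√(n : ℝ) * (jarzynskiEstimate (fun ε => Real.exp (-W ε)) (fun i : Fin n => ω i) - ΔF) /
          √(1 / essHat (fun i : Fin n => Real.exp (-W (ω i))) - 1)| ≤ z})
      atTop (𝓝 (gaussianReal 0 1 (Icc (-z) z))) := by
  haveI := isProbabilityMeasure_fwdPathLaw ν₀ h0 κF
  have key := tendsto_measure_abs_studentized_le (fwdPathLaw ν₀ κF)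
    (w := fun ε => Real.exp (-W ε)) (Real.measurable_exp.comp h.measurable_W.neg)
    (fun ε => Real.exp_pos _) hL2 hvar hz
  rwa [h.integral_exp_neg_work, ← hΔF, Real.log_exp, neg_neg] at key

end CrooksPair

end Summit.Ventures.LatticeQCDFlow.Exactness.GeneralNCMC
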